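import Literature.Computability.MetaComplexity.AvgCaseNEUniform
import Literature.Computability.MetaComplexity.OneSidedHeuristics
import Literature.Computability.Complexity.FoldBricks
import Literature.Computability.Complexity.PlumbingBricks
import Literature.Computability.Complexity.FPStringBricks
import Literature.Computability.Complexity.BinarySubtraction
import HarnessLib

/-!
# One-sided heuristics for `coNP` on the tally ensemble collapse `NE` to `E` (BCGL92; Hirahara 2021, Lemma 3.4, item 1)

Topic `Literature/Computability/MetaComplexity`, companion to `OneSidedHeuristics.lean` (`Avg¹_δ P`,
the tally ensemble `T`, Hirahara's hypothesis `coNP × {U, T} ⊆ Avg¹_{1-n^{-c}} P`) and to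
`AvgCaseNE.lean` / `AvgCaseNEUniform.lean` (the same collapse from the *strong* hypothesis
`DistNP ⊆ AvgP`, Buhrman–Fortnow–Pavan 2005, Thm. 3.5). It PROVES the first of the four steps of the
proof sketch of Lemma 3.4 of S. Hirahara, *Average-case hardness of NP from exponential worst-case
hardness assumptions* (STOC 2021; full version ECCC TR21-058, p. 20):

> "1. `coNP × {T} ⊆ Avg¹_{1-n^{-c}} P` implies `NE = E` [BCGL92]."

Lemma 3.4 (a pseudorandom generator from the weak hypothesis; used in the paper as
`pr-BPP = pr-P`, p. 27 and Eq. (13)) is one of the three remaining leaves of the named fact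
`Hirahara2021_UP_searchUHS_of_Avg1P` (Thm. 8.9 for `UP`, `SearchHeuristicSchemesProofs.lean`) and of
the proofs of `Hirahara2021_languageCompression` (Thm. 4.2) and `Hirahara2021_gapKvsK_mem_PromiseP`
(Lemma 5.1); the other steps are [KS04] (`coNP × {U} ⊆ Avg¹_{1-n^{-c}} P ⟹ pr-MA = pr-NP`), [BFP05]
(`NE = E ∧ pr-MA = pr-NP ⟹ E ⊄ i.o.SIZE(2^{εn})`) and [IW97] (in the tree:
`Complexity.impagliazzo_wigderson_holds`, `Complexity.PromiseBPP'_subset_PromiseP_of_avgHard_E`).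

Main results (hypothesis `∃ c, distClass coNP {tallyEnsemble} ⊆ Avg1DeltaP (1 - n^{-c})`, and the
wrappers from Hirahara's `∃ c, distClass coNP {uniformEnsemble, tallyEnsemble} ⊆ …`):

* `AvgTallyNE.exists_decider_of_mem_NP` — under the tally hypothesis every `NP` language is decided
  exactly on the tally words `1ⁿ`, `n ≥ 1`, by a polynomial-time algorithm (a one-sided-error
  heuristic for `(Ltᶜ, T)` with success probability `≥ n^{-c} > 0` under the point mass `Tₙ` is
  correct on `1ⁿ`);
* `AvgTallyNE.NTIME_two_pow_mul_subset_E_of_tally` — hence `NTIME(2^{an}) ⊆ E` for every `a`;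
* **`AvgTallyNE.E_eq_NE_of_tally`**, **`Hirahara2021_E_eq_NE_of_Avg1P`** — `E = NE`;
* `AvgTallyNE.exists_NTIME_two_pow_subset_DTIME_of_tally`,
  `Hirahara2021_exists_NTIME_two_pow_subset_DTIME_of_Avg1P` — `∃ e, NTIME(2ⁿ) ⊆ DTIME(2^{en})`, the
  [IKW02] form in which Buhrman–Fortnow–Pavan's diagonal argument (item 3) consumes `NE = E`
  (through the complete language `AvM.K U` of `NTIME(2^{O(n)})`, exactly as in
  `exists_NTIME_two_pow_subset_DTIME_of_DistNP_subset_AvgP`).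

## Proof

The classical tally translation (Book 1974; Arora–Barak 2009, §2.6.2), with the tally code
`x ↦ 1^{tnum x}`, `tnum x = ⟦x1⟧₂ ∈ [2^{|x|}, 2^{|x|+1})` (binary numerals least significant bit first,
Mathlib's `encodeNat`):

* (A) the decoder `tallyDecodeFn : 1ᴺ ↦ x` (`encodeNat N = x1` without its last bit; `FP` bricks
  `lenBinF`, `takeFn`, `dropFn`) inverts the code and outputs `≤ log₂ N + 1` bits;
* (B) the pad `tallyPadFn : x ↦ ⟨1^{tnum x}, 1^{tnum x}⟩ = paramEnc (1^{tnum x}, tnum x)` is in `FE`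
  (time `2^{O(|x|)}`: the exponential ruler `expPad 1`, `mapFstFn_mem_FE`, and the capped
  binary-to-unary conversion `binToUnaryFn`);
* (C) for `L ∈ NTIME(2^{an})` the tally language `T(L) = 1* ⊓ {w | tallyDecodeFn w ∈ L}` is in `NP`
  (the verifier of `AvgNE.logTruncLang_mem_NP` with the tally decoder in place of the pair
  truncation: clock `w ↦ ⟨x, 1^{c 2^{a|x|} + c}⟩`, truncating wrapper `truncMapAux`, then the
  `NTIME` verifier of `L`, polynomial in `|w| ≥ 2^{|x|}`), and `x ∈ L ↔ 1^{tnum x} ∈ T(L)`;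
* (D) the heuristic `A` of `(T(L)ᶜ, T) ∈ coNP × {T} ⊆ Avg¹_{1-n^{-c}} P` satisfies
  `Pr_{w ∼ Tₙ}[A(w; 1ⁿ) = T(L)ᶜ(w)] ≥ n^{-c} > 0`, and `Tₙ` is the point mass on `1ⁿ`, so
  `A(1ⁿ; 1ⁿ) = [1ⁿ ∉ T(L)]` for `n ≥ 1`;
* (E) `x ∈ L ↔ A(1^{tnum x}; 1^{tnum x}) = 0`; composing the `FE` pad with the polynomial-time `A`
  (`TimeComputable.comp_holds`) decides the complement of `L` in time `2^{O(n)}`, and `E` is closed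
  under complement (`compl_mem_DTIME_iff`); `NE ⊆ E` exponent by exponent, `E ⊆ NE` is
  `E_subset_NE` (`AvgCaseNE.lean`).

## References

* S. Hirahara, *Average-case hardness of NP from exponential worst-case hardness assumptions*,
  STOC 2021; full version ECCC TR21-058 (2021): Lemma 3.4 and its proof sketch (p. 20), Def. 3.3,
  p. 9 (the tally distribution `T`) [Hirahara2021] (text checked: ECCC TR21-058, p. 20).
* S. Ben-David, B. Chor, O. Goldreich, M. Luby, *On the theory of average case complexity*,
  J. Comput. Syst. Sci. 44 (1992) 193–219 (the cited source of item 1).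
* H. Buhrman, L. Fortnow, A. Pavan, *Some results on derandomization*, Theory Comput. Syst. 38 (2005),
  Thm. 3.5 and proof of Thm. 3.1 [BuhrmanFortnowPavan2004].
* R. V. Book, *Tally languages and complexity classes*, Inform. Control 26 (1974) (`NE = E` iff every
  tally language in `NP` is in `P`); S. Arora, B. Barak, *Computational Complexity: A Modern
  Approach*, CUP 2009, §2.6.2 (padding), §1.3 [AroraBarakCC2009].

## Design notes

* No definition of mathematical content and no named fact is introduced (D-0026): `tnum`,
  `tallyDecodeFn`, `tallyPadFn`, `boundT`, `clockT`, `tallyTruncLang`, `tallyLang` are proof devices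
  of this file (namespace `AvgTallyNE`).
* Only the tally half of Hirahara's hypothesis is used; the statements are also given for the full
  hypothesis `coNP × {U, T} ⊆ Avg¹_{1-n^{-c}} P` exactly as it is written in
  `Hirahara2021_UP_searchUHS_of_Avg1P` (`distClass coNP {uniformEnsemble, tallyEnsemble} ⊆
  Avg1DeltaP fun n => 1 - 1 / (n : ℝ) ^ c`). At `n = 0` the success bound `0^{-c}` is void in Lean
  (`1 / 0 = 0`) and the argument only uses tally words `1ᴺ` with `N = tnum x ≥ 1`.
-/

noncomputable section

namespace Literature.Computability.MetaComplexity

open _root_.Computability Turing Polynomial Complexity Complexity.PairFstTM Brick Plumb Nondeterministic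

namespace AvgTallyNE

/-! ### A. The tally code of a string and its polynomial-time decoder -/

/-- The **tally code number** of `x`: the positive integer whose binary numeral (least significant
bit first, Mathlib's `encodeNat`) is `x1`, i.e. `tnum x = ⟦x⟧ + 2^{|x|}`; `x` is coded by the tally
string `1^{tnum x}`. [Book 1974; Arora–Barak 2009, §2.6.2] [folklore] -/
def tnum (x : List Bool) : ℕ := bitsToNat (x ++ [true])

/-- `tnum x = ⟦x⟧ + 2^{|x|}`. [folklore] -/
theorem tnum_eq (x : List Bool) : tnum x = bitsToNat x + 2 ^ x.length := bitsToNat_append_true x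

/-- Tally code numbers are positive. [folklore] -/
theorem one_le_tnum (x : List Bool) : 1 ≤ tnum x := by
  rw [tnum_eq]; exact le_add_left Nat.one_le_two_pow

/-- `tnum x < 2^{|x|+1}`. [folklore] -/
theorem tnum_lt (x : List Bool) : tnum x < 2 ^ (x.length + 1) := by
  rw [tnum_eq, pow_succ]
  have := bitsToNat_lt x
  omega

/-- The binary numeral of the code number is `x1`. [folklore] -/
theorem encodeNat_tnum (x : List Bool) : encodeNat (tnum x) = x ++ [true] :=
  encodeNat_bitsToNat (isCanonicalNum_append_true x)

/-- **The tally decoder** `w ↦ x` where `x1 = encodeNat |w|` (the binary numeral of the length with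
its leading bit removed): `takeFn ⟨1^{|u|-1}, u⟩` for `u = encodeNat |w|` (`lenBinF`). [folklore] -/
def tallyDecodeFn : List Bool → List Bool :=
  takeFn ∘ fanoutFn (dropFn ∘ fanoutFn (fun _ => [true]) (onesFn ∘ lenBinF)) lenBinF

/-- `tallyDecodeFn ∈ FP`. [folklore] -/
theorem tallyDecodeFn_mem_FP : tallyDecodeFn ∈ FP :=
  comp_mem_FP takeFn_mem_FP (fanoutFn_mem_FP (comp_mem_FP dropFn_mem_FP
    (fanoutFn_mem_FP (const_mem_FP [true]) (comp_mem_FP onesFn_mem_FP lenBinF_mem_FP))) lenBinF_mem_FP)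

/-- Value of the decoder. [folklore] -/
theorem tallyDecodeFn_apply (w : List Bool) :
    tallyDecodeFn w = (encodeNat w.length).take ((encodeNat w.length).length - 1) := by
  simp [tallyDecodeFn, fanoutFn_apply, onesFn, unaryEncodeNat_eq_replicate]

/-- **The decoder inverts the tally code**: `tallyDecodeFn 1^{tnum x} = x`. [folklore] -/
theorem tallyDecodeFn_unaryEncodeNat_tnum (x : List Bool) : tallyDecodeFn (unaryEncodeNat (tnum x)) = x := by
  rw [tallyDecodeFn_apply]
  simp [unaryEncodeNat_eq_replicate, encodeNat_tnum]

/-- The decoded word is logarithmically short: `2^{|tallyDecodeFn w|} ≤ 2|w| + 2`. [folklore] -/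
theorem two_pow_length_tallyDecodeFn_le (w : List Bool) :
    2 ^ (tallyDecodeFn w).length ≤ 2 * w.length + 2 := by
  rw [tallyDecodeFn_apply, List.length_take]
  set N := w.length
  have hN : N < 2 ^ (Nat.log 2 N + 1) := Nat.lt_pow_succ_log_self one_lt_two N
  have hlt : N < bitsToNat (ones (Nat.log 2 N + 2)) := by
    rw [bitsToNat_ones, pow_succ]
    have : 1 ≤ 2 ^ (Nat.log 2 N + 1) := Nat.one_le_two_pow
    omega
  have hlen : (encodeNat N).length ≤ Nat.log 2 N + 2 := by
    simpa [ones] using length_encodeNat_le_of_lt hlt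
  have hmin : min ((encodeNat N).length - 1) (encodeNat N).length ≤ Nat.log 2 N + 1 := by omega
  calc 2 ^ min ((encodeNat N).length - 1) (encodeNat N).length ≤ 2 ^ (Nat.log 2 N + 1) :=
        Nat.pow_le_pow_right two_pos hmin
    _ = 2 * 2 ^ Nat.log 2 N := by rw [pow_succ, mul_comm]
    _ ≤ 2 * N + 2 := by
        rcases Nat.eq_zero_or_pos N with h | h
        · simp [h]
        · have := Nat.pow_log_le_self 2 h.ne'
          omega

/-- Hence `2^{a |tallyDecodeFn w|} ≤ (2|w| + 2)^a`. [folklore] -/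
theorem two_pow_mul_length_tallyDecodeFn_le (a : ℕ) (w : List Bool) :
    2 ^ (a * (tallyDecodeFn w).length) ≤ (2 * w.length + 2) ^ a := by
  rw [mul_comm, pow_mul]
  exact Nat.pow_le_pow_left (two_pow_length_tallyDecodeFn_le w) a

/-- The decoded word is shorter than the tally word (plus one). [folklore] -/
theorem length_tallyDecodeFn_le (w : List Bool) : (tallyDecodeFn w).length ≤ w.length + 1 := by
  have h2 := two_pow_length_tallyDecodeFn_le w
  have h3 : 2 * w.length + 2 ≤ 2 ^ (w.length + 1) := by
    have := @Nat.lt_two_pow_self w.length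
    rw [pow_succ]
    omega
  exact (Nat.pow_le_pow_iff_right (by norm_num)).1 (h2.trans h3)

/-! ### B. The tally pad `x ↦ ⟨1^{tnum x}, 1^{tnum x}⟩` is computable in time `2^{O(|x|)}` -/

/-- The **tally pad** `x ↦ ⟨1^{tnum x}, 1^{tnum x}⟩ = paramEnc (1^{tnum x}, tnum x)`: append the
leading bit, copy, expand the first copy to the ruler `expPad 1` (of length `> 2^{|x|+1} > tnum x`),
convert the numeral `x1` to unary against that ruler, copy. [Book 1974; Arora–Barak 2009, §2.6.2
(padding)] [folklore] -/
def tallyPadFn : List Bool → List Bool :=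
  copyFn ∘ (binToUnaryFn ∘ (mapFstFn (expPad 1) ∘ (copyFn ∘ fun x => x ++ [true])))

/-- Value of the tally pad. [folklore] -/
theorem tallyPadFn_apply (x : List Bool) :
    tallyPadFn x = paramEnc (unaryEncodeNat (tnum x), tnum x) := by
  have hmin : min (bitsToNat (x ++ [true])) (expPad 1 (x ++ [true])).length = tnum x := by
    rw [length_expPad, pow_one, List.length_append, List.length_singleton]
    exact min_eq_left (by have := tnum_lt x; unfold tnum at *; omega)
  simp only [tallyPadFn, Function.comp_apply, copyFn_apply, mapFstFn_boolPair, binToUnaryFn_boolPair,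
    hmin, paramEnc, unaryEncodeNat_eq_replicate]

/-- **The tally pad is computable in time `2^{O(n)}`**: `tallyPadFn ∈ FE`. [cite: AroraBarakCC2009, §2.6.2 (Thm. 2.22, padding)] -/
theorem tallyPadFn_mem_FE : tallyPadFn ∈ FE := by
  refine comp_mem_FE copyFn_mem_FP (comp_mem_FE binToUnaryFn_mem_FP ?_)
  refine comp_mem_FE_of_linear (mapFstFn_mem_FE expPad_one_mem_FE)
    (comp_mem_FP copyFn_mem_FP (append_mem_FP OracleCompose.id_mem_FP (const_mem_FP [true]))) 5
    fun w => ?_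
  simp only [Function.comp_apply, copyFn_apply, length_boolPair, List.length_append,
    List.length_singleton]
  omega

/-! ### C. Tally codes of `NTIME(2^{an})` languages are `NP` languages -/

section TallyNP

variable (a c : ℕ)

/-- **The witness bound in unary**, `w ↦ 1^{c · 2^{a|x|} + c}` with `x = tallyDecodeFn w`, through
the capped binary-to-unary conversion (the cap `(2|w|+2)^a` never bites). [folklore] -/
def boundT : List Bool → List Bool :=
  polyFn (Polynomial.C c * X + Polynomial.C c) ∘ binToUnaryFn ∘
    fanoutFn (polyFn ((2 * X + 2) ^ a)) (AvgNE.pow2NumF a ∘ tallyDecodeFn)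

/-- `boundT a c ∈ FP`. [folklore] -/
theorem boundT_mem_FP : boundT a c ∈ FP :=
  comp_mem_FP (polyFn_mem_FP _) (comp_mem_FP binToUnaryFn_mem_FP
    (fanoutFn_mem_FP (polyFn_mem_FP _) (comp_mem_FP (AvgNE.pow2NumF_mem_FP a) tallyDecodeFn_mem_FP)))

/-- Value of the bound: `boundT a c w = 1^{c · 2^{a|tallyDecodeFn w|} + c}`. [folklore] -/
theorem boundT_apply (w : List Bool) :
    boundT a c w = ones (c * 2 ^ (a * (tallyDecodeFn w).length) + c) := by
  have hmin : min (2 ^ (a * (tallyDecodeFn w).length)) ((2 * w.length + 2) ^ a) =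
      2 ^ (a * (tallyDecodeFn w).length) := min_eq_left (two_pow_mul_length_tallyDecodeFn_le a w)
  simp [boundT, Function.comp_apply, fanoutFn_apply, binToUnaryFn_boolPair,
    AvgNE.bitsToNat_pow2NumF, ones, hmin]

/-- **The clock of the verifier**: `w ↦ ⟨x, 1^{c·2^{a|x|}+c}⟩`, `x = tallyDecodeFn w`. [folklore] -/
def clockT : List Bool → List Bool := fanoutFn tallyDecodeFn (boundT a c)

/-- `clockT a c ∈ FP`. [folklore] -/
theorem clockT_mem_FP : clockT a c ∈ FP := fanoutFn_mem_FP tallyDecodeFn_mem_FP (boundT_mem_FP a c)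

/-- Some machine computes the clock within polynomially many steps. [folklore] -/
theorem exists_clockT_machine :
    ∃ (q : Polynomial ℕ) (N : TM2ComputableAux Bool Bool), ∀ w : List Bool,
      N.OutputsWithin w (boolPair (tallyDecodeFn w) (ones (c * 2 ^ (a * (tallyDecodeFn w).length) + c)))
        (q.eval w.length) := by
  obtain ⟨q, N, hN⟩ := clockT_mem_FP a c
  refine ⟨q, N, fun w => ?_⟩
  have h := hN w
  rw [clockT, fanoutFn_apply, boundT_apply] at h
  exact h

variable {a}

/-- The **tally truncation language** `{w | tallyDecodeFn w ∈ L}` of `L`. [folklore] -/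
def tallyTruncLang (L : Language Bool) : Language Bool := {w | tallyDecodeFn w ∈ L}

/-- **`L ∈ NTIME(2^{an}) ⇒ tallyTruncLang L ∈ NP`.** Let `(c, R, M)` present `L`. The witness
language is `V = {u | R x ((readRest u) ↾ B) = 1}` with `x = tallyDecodeFn (fst u)`,
`B = c · 2^{a|x|} + c`: it is in `P`, decided by the truncating wrapper `truncMapAux` of the clock
`fst u ↦ ⟨x, 1^B⟩` followed by `M`, which on such an admissible pair halts within
`B ≤ c (2|u| + 2)^a + c` steps. Correctness: `w ∈ tallyTruncLang L ↔ x ∈ L ↔ ∃ y, |y| ≤ B ∧ R x y = 1`,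
and such `y` are exactly the kept parts of witnesses of length `≤ c(2|w|+2)^a + c` (verbatim the
argument of `AvgNE.logTruncLang_mem_NP` with the tally decoder in place of the pair truncation).
[cite: AroraBarakCC2009, §2.6.2 (Thm. 2.22, padding)] -/
theorem tallyTruncLang_mem_NP {L : Language Bool} (hL : L ∈ NTIME (fun n => 2 ^ (a * n))) :
    tallyTruncLang L ∈ NP := by
  obtain ⟨c, R, M, hM, hLR⟩ := hL
  obtain ⟨q, Nc, hNc⟩ := exists_clockT_machine a c
  -- the witness language, through its defining equation
  obtain ⟨V, hV⟩ : ∃ V : Language Bool, V = {u | R (tallyDecodeFn (boolUnpair u).1)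
      ((readRest u).take (c * 2 ^ (a * (tallyDecodeFn (boolUnpair u).1).length) + c)) = true} :=
    ⟨_, rfl⟩
  have hmemV : ∀ u : List Bool, u ∈ V ↔ R (tallyDecodeFn (boolUnpair u).1)
      ((readRest u).take (c * 2 ^ (a * (tallyDecodeFn (boolUnpair u).1).length) + c)) = true :=
    fun u => by
    rw [hV]
    exact Iff.rfl
  -- `V ∈ P`: truncate the witness, then run `M`
  have hVP : V ∈ Classes.P := by
    refine timeClass_subset_P_of_polynomial_holds
      (q + Polynomial.C (3 * c) * (2 * X + 2) ^ a + 5 * X + Polynomial.C (3 * c + 12)) ?_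
    refine ⟨(truncMapAux Nc).comp M, fun u => ?_⟩
    have hclock := hNc (boolUnpair u).1
    have h₁ := outputsWithin_truncMapAux Nc (z := u) hclock
    simp only [List.length_replicate] at h₁
    have hy' : ((readRest u).take (c * 2 ^ (a * (tallyDecodeFn (boolUnpair u).1).length) + c)).length ≤
        c * 2 ^ (a * (tallyDecodeFn (boolUnpair u).1).length) + c := List.length_take_le _ _
    have h₂ := hM (tallyDecodeFn (boolUnpair u).1) _ hy'
    have h := TM2ComputableAux.comp_outputsWithin _ _ h₁ h₂
    have hind : R (tallyDecodeFn (boolUnpair u).1)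
        ((readRest u).take (c * 2 ^ (a * (tallyDecodeFn (boolUnpair u).1).length) + c)) =
          V.boolIndicator u := by
      rw [Bool.eq_iff_iff]
      exact ⟨fun h => (Set.mem_iff_boolIndicator _ _).1 ((hmemV u).2 h),
        fun h => (hmemV u).1 ((Set.mem_iff_boolIndicator _ _).2 h)⟩
    rw [hind] at h
    refine h.mono ?_
    -- the estimates, all polynomial in `|u|`
    have hwu : (boolUnpair u).1.length ≤ u.length := length_boolUnpair_fst_le u
    have hx : (tallyDecodeFn (boolUnpair u).1).length ≤ (boolUnpair u).1.length + 1 :=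
      length_tallyDecodeFn_le _
    have hpow : 2 ^ (a * (tallyDecodeFn (boolUnpair u).1).length) ≤ (2 * u.length + 2) ^ a :=
      (two_pow_mul_length_tallyDecodeFn_le a _).trans (Nat.pow_le_pow_left (by omega) a)
    have hr : (readRest u).length ≤ u.length := by
      have := readSteps_add_le u
      have := one_le_readSteps u
      omega
    have hsub : u.length - (readRest u).length ≤ u.length := Nat.sub_le _ _
    have hdiv : (readRest u).length / 2 ≤ u.length := (Nat.div_le_self _ _).trans hr
    have hq : q.eval (boolUnpair u).1.length ≤ q.eval u.length := TM2Iter.eval_mono q hwu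
    have e1 : c * 2 ^ (a * (tallyDecodeFn (boolUnpair u).1).length) ≤ c * (2 * u.length + 2) ^ a :=
      Nat.mul_le_mul_left c hpow
    simp only [id, eval_add, eval_mul, eval_C, eval_X, eval_pow, eval_ofNat]
    linarith [e1, hq, hx, hwu, hsub, hdiv, Nat.zero_le (c * (2 * u.length + 2) ^ a)]
  -- the `NP` presentation
  refine ⟨V, hVP, Polynomial.C c * (2 * X + 2) ^ a + Polynomial.C c, fun w => ?_⟩
  have hmem : ∀ y : List Bool, boolPair w y ∈ V ↔
      R (tallyDecodeFn w) (y.take (c * 2 ^ (a * (tallyDecodeFn w).length) + c)) = true := fun y => by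
    simp only [hmemV, boolUnpair_boolPair, readRest_boolPair]
  have hB : c * 2 ^ (a * (tallyDecodeFn w).length) + c ≤ c * (2 * w.length + 2) ^ a + c :=
    Nat.add_le_add_right (Nat.mul_le_mul_left c (two_pow_mul_length_tallyDecodeFn_le a w)) c
  change tallyDecodeFn w ∈ L ↔ _
  rw [hLR (tallyDecodeFn w)]
  simp only [eval_add, eval_mul, eval_C, eval_X, eval_pow, eval_ofNat]
  constructor
  · rintro ⟨y, hy, hRy⟩
    refine ⟨y, hy.trans hB, (hmem y).2 ?_⟩
    rwa [List.take_of_length_le hy]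
  · rintro ⟨y, -, hy⟩
    exact ⟨_, List.length_take_le _ _, (hmem y).1 hy⟩

variable (a)

/-- **The tally words form a language in `P`**: `{w | onesFn w = w} = {1ⁿ | n ∈ ℕ}` (equality test
of two `FP` maps). [folklore] -/
theorem tallyFmt_mem_P : ({w | onesFn w = w} : Language Bool) ∈ Classes.P := by
  have h := setOf_apply_eq_apply_mem_P onesFn_mem_FP OracleCompose.id_mem_FP
  simpa only [id_eq] using h

/-- `1ⁿ` is a tally word. [folklore] -/
theorem unaryEncodeNat_mem_tallyFmt (n : ℕ) :
    unaryEncodeNat n ∈ ({w | onesFn w = w} : Language Bool) := by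
  change onesFn (unaryEncodeNat n) = unaryEncodeNat n
  have hlen : (unaryEncodeNat n).length = n := unary_decode_encode_nat n
  rw [onesFn, hlen]

/-- The **tally language** of `L`: `T(L) = {1^{tnum x} | x ∈ L} = {w | w ∈ 1* ∧ tallyDecodeFn w ∈ L}`.
[Book 1974; Arora–Barak 2009, §2.6.2] [folklore] -/
def tallyLang (L : Language Bool) : Language Bool := {w | onesFn w = w} ⊓ tallyTruncLang L

variable {a}

/-- **The tally language of an `NTIME(2^{an})` language is in `NP`** (`T(L) = 1* ⊓ tallyTruncLang L`,
`P`-language meet `NP`-language). [cite: AroraBarakCC2009, §2.6.2 (Thm. 2.22, padding)] -/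
theorem tallyLang_mem_NP {L : Language Bool} (hL : L ∈ NTIME (fun n => 2 ^ (a * n))) :
    tallyLang L ∈ NP :=
  inter_P_mem_polyExists (fun _ _ h₁ h₂ => inter_mem_P h₁ h₂) tallyFmt_mem_P (tallyTruncLang_mem_NP hL)

/-- **The tally code is a reduction**: `x ∈ L ↔ 1^{tnum x} ∈ T(L)`. [Book 1974] [folklore] -/
theorem mem_iff_unaryEncodeNat_tnum_mem_tallyLang (L : Language Bool) (x : List Bool) :
    x ∈ L ↔ unaryEncodeNat (tnum x) ∈ tallyLang L := by
  change x ∈ L ↔ unaryEncodeNat (tnum x) ∈ ({w | onesFn w = w} : Language Bool) ∧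
    tallyDecodeFn (unaryEncodeNat (tnum x)) ∈ L
  rw [tallyDecodeFn_unaryEncodeNat_tnum]
  exact ⟨fun hx => ⟨unaryEncodeNat_mem_tallyFmt _, hx⟩, fun h => h.2⟩

end TallyNP

/-! ### D. Under the tally hypothesis, tally `NP` languages are decided in polynomial time -/

/-- **A one-sided-error heuristic on the tally ensemble is an exact decider.** If
`coNP × {T} ⊆ Avg¹_{1-n^{-c}} P` then for every `Lt ∈ NP` there is a polynomial-time `A(w; 1ⁿ)` with
`A(1ⁿ; 1ⁿ) = 1 ↔ 1ⁿ ∉ Lt` for all `n ≥ 1`: the heuristic for `(Ltᶜ, T) ∈ coNP × {T}` is correct on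
`supp Tₙ = {1ⁿ}` with probability `≥ n^{-c} > 0`, and a point mass has no event of probability
strictly between `0` and `1` (Hirahara: "coNP × {T} ⊆ Avg¹_{1-n^{-c}} P implies NE = E [BCGL92]",
the tally sets in `coNP` being then in `P`). [Hirahara 2021 (ECCC TR21-058), Lemma 3.4, proof
sketch, item 1; Ben-David–Chor–Goldreich–Luby 1992] [cite: Hirahara2021, Lemma 3.4 (proof sketch, item 1)] -/
theorem exists_decider_of_mem_NP
    (H : ∃ c : ℕ, distClass coNP {tallyEnsemble} ⊆ Avg1DeltaP fun n => 1 - 1 / (n : ℝ) ^ c)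
    {Lt : Language Bool} (hLt : Lt ∈ NP) :
    ∃ A : List Bool → ℕ → Bool, PolyTimeComputable paramEnc encodeBool (Function.uncurry A) ∧
      ∀ n : ℕ, 1 ≤ n → (A (unaryEncodeNat n) n = true ↔ unaryEncodeNat n ∉ Lt) := by
  obtain ⟨c, hc⟩ := H
  have hco : Ltᶜ ∈ coNP := by
    change Ltᶜᶜ ∈ NP
    rwa [compl_compl]
  have hQ : (⟨Ltᶜ, tallyEnsemble⟩ : DistProblem) ∈ distClass coNP {tallyEnsemble} :=
    ⟨hco, Set.mem_singleton _⟩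
  obtain ⟨A, hA, -, h2⟩ := hc hQ
  refine ⟨A, hA, fun n hn => ?_⟩
  have key : A (unaryEncodeNat n) n = Ltᶜ.boolIndicator (unaryEncodeNat n) := by
    by_contra hne
    have h0 : tallyEnsemble.prob n {x | A x n = Ltᶜ.boolIndicator x} = 0 :=
      prob_tallyEnsemble_of_not_mem hne
    have h := h2 n
    change 1 - (1 - 1 / (n : ℝ) ^ c) ≤ tallyEnsemble.prob n {x | A x n = Ltᶜ.boolIndicator x} at h
    rw [h0] at h
    have hpos : (0 : ℝ) < 1 / (n : ℝ) ^ c := by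
      have hn' : (0 : ℝ) < n := by exact_mod_cast hn
      positivity
    linarith
  rw [key]
  exact ⟨fun h => (Set.mem_iff_boolIndicator _ _).2 h, fun h => (Set.mem_iff_boolIndicator _ _).1 h⟩

/-! ### E. `NTIME(2^{an}) ⊆ E`, `NE = E`, and one exponent for `NTIME(2ⁿ)` -/

/-- **`coNP × {T} ⊆ Avg¹_{1-n^{-c}} P ⟹ NTIME(2^{an}) ⊆ E`** (every `a`). For `L ∈ NTIME(2^{an})` the
tally language `T(L) = {1^{tnum x} | x ∈ L}` is in `NP` (`tallyLang_mem_NP`), so by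
`exists_decider_of_mem_NP` some polynomial-time `A` has `A(1ᴺ; 1ᴺ) = 1 ↔ 1ᴺ ∉ T(L)` (`N ≥ 1`);
then `x ∈ L ↔ 1^{tnum x} ∈ T(L) ↔ A(1^{tnum x}; 1^{tnum x}) = 0`, and `x ↦ ⟨1^{tnum x}, 1^{tnum x}⟩`
takes time `2^{O(|x|)}` (`tallyPadFn_mem_FE`), so `L` is the complement of a language decided in time
`2^{O(n)}` ("the tally sets in NP are in P which implies that E = NE", translation by padding).
[Hirahara 2021 (ECCC TR21-058), Lemma 3.4 (proof sketch, item 1); Ben-David–Chor–Goldreich–Luby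
1992; Book 1974; Arora–Barak 2009, §2.6.2] [cite: Hirahara2021, Lemma 3.4 (proof sketch, item 1)] -/
theorem NTIME_two_pow_mul_subset_E_of_tally
    (H : ∃ c : ℕ, distClass coNP {tallyEnsemble} ⊆ Avg1DeltaP fun n => 1 - 1 / (n : ℝ) ^ c)
    (a : ℕ) : NTIME (fun n => 2 ^ (a * n)) ⊆ E := by
  intro L hL
  obtain ⟨A, hA, hdec⟩ := exists_decider_of_mem_NP H (tallyLang_mem_NP hL)
  -- the codes accepted by `A` form a language decided in time `2^{O(n)}`
  obtain ⟨Lacc, hLacc⟩ : ∃ Lacc : Language Bool,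
      Lacc = {x | A (unaryEncodeNat (tnum x)) (tnum x) = true} := ⟨_, rfl⟩
  have hmemLacc : ∀ x : List Bool, x ∈ Lacc ↔ A (unaryEncodeNat (tnum x)) (tnum x) = true :=
    fun x => by rw [hLacc]; exact Iff.rfl
  have hLeq : L = Laccᶜ := by
    ext x
    have hcx : x ∈ Laccᶜ ↔ x ∉ Lacc := Iff.rfl
    rw [mem_iff_unaryEncodeNat_tnum_mem_tallyLang L x, hcx, hmemLacc,
      hdec (tnum x) (one_le_tnum x), not_not]
  have hLaccE : Lacc ∈ E := by
    obtain ⟨s, hs, -, hsl⟩ := exists_length_le_of_mem_FE tallyPadFn_mem_FE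
    obtain ⟨c, K, hK⟩ := mem_FE_iff.1 tallyPadFn_mem_FE
    obtain ⟨p, hp⟩ := hA
    -- the pad computes `g x = (1^{tnum x}, tnum x)` under the encoding `paramEnc`
    have hg : TimeComputable (id : List Bool → List Bool) paramEnc
        (fun x => (unaryEncodeNat (tnum x), tnum x)) fun n => K * 2 ^ (c * n) + K := by
      obtain ⟨M, hM⟩ := hK
      refine ⟨M, fun x => ?_⟩
      have h := hM x
      simp only [id, tallyPadFn_apply] at h
      exact h
    have hmono : Monotone fun n : ℕ => p.eval n := fun x y h => TM2Iter.eval_mono p h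
    have hsl' : ∀ x : List Bool,
        (paramEnc ((fun x => (unaryEncodeNat (tnum x), tnum x)) x)).length ≤ s (id x : List Bool).length :=
      fun x => by rw [← tallyPadFn_apply]; exact hsl x
    obtain ⟨C, hC⟩ := TimeComputable.comp_holds hp hg hmono (s := s) hsl'
    have hind : Function.uncurry A ∘ (fun x => (unaryEncodeNat (tnum x), tnum x)) = Lacc.boolIndicator := by
      funext x
      simp only [Function.comp_apply, Function.uncurry_apply_pair]
      by_cases hx : A (unaryEncodeNat (tnum x)) (tnum x) = true
      · rw [hx]
        exact ((Set.mem_iff_boolIndicator Lacc x).1 ((hmemLacc x).2 hx)).symm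
      · have hx' : A (unaryEncodeNat (tnum x)) (tnum x) = false := by simpa using hx
        rw [hx']
        exact ((Set.notMem_iff_boolIndicator Lacc x).1 (fun h => hx ((hmemLacc x).1 h))).symm
    rw [hind] at hC
    have h3 := ((((IsExpBounded.shape c K).add (hs.poly_comp p)).add hs).const_mul C).add
      (IsExpBounded.const C)
    obtain ⟨c', K', hK'⟩ : ∃ c' K' : ℕ, ∀ n,
        C * (K * 2 ^ (c * n) + K + p.eval (s n) + s n) + C ≤ K' * 2 ^ (c' * n) + K' :=
      (h3.mono fun n => le_rfl).exists_le_mul_add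
    have hfin : Lacc ∈ TimeClass fun n => K' * 2 ^ (c' * n) + K' := hC.mono hK'
    exact Set.mem_iUnion.2 ⟨c', K', hfin⟩
  rw [hLeq]
  simp only [E, Set.mem_iUnion, compl_mem_DTIME_iff] at hLaccE ⊢
  exact hLaccE

/-- **Ben-David–Chor–Goldreich–Luby under the tally hypothesis: `coNP × {T} ⊆ Avg¹_{1-n^{-c}} P ⟹
NE ⊆ E`** (each exponent by `NTIME_two_pow_mul_subset_E_of_tally`).
[Hirahara 2021 (ECCC TR21-058), Lemma 3.4 (proof sketch, item 1); BCGL92]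
[cite: Hirahara2021, Lemma 3.4 (proof sketch, item 1)] -/
theorem NE_subset_E_of_tally
    (H : ∃ c : ℕ, distClass coNP {tallyEnsemble} ⊆ Avg1DeltaP fun n => 1 - 1 / (n : ℝ) ^ c) :
    NE ⊆ E := by
  intro L hL
  simp only [NE, Set.mem_iUnion] at hL
  obtain ⟨c, hc⟩ := hL
  exact NTIME_two_pow_mul_subset_E_of_tally H c hc

/-- **`coNP × {T} ⊆ Avg¹_{1-n^{-c}} P ⟹ E = NE`** (with the unconditional `E ⊆ NE`,
`E_subset_NE`). [Hirahara 2021 (ECCC TR21-058), Lemma 3.4 (proof sketch, item 1): "coNP × {T} ⊆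
Avg¹_{1-n^{-c}} P implies NE = E [BCGL92]"] [cite: Hirahara2021, Lemma 3.4 (proof sketch, item 1)] -/
theorem E_eq_NE_of_tally
    (H : ∃ c : ℕ, distClass coNP {tallyEnsemble} ⊆ Avg1DeltaP fun n => 1 - 1 / (n : ℝ) ^ c) :
    E = NE :=
  Set.Subset.antisymm E_subset_NE (NE_subset_E_of_tally H)

/-- **Under the tally hypothesis, `NTIME(2ⁿ) ⊆ DTIME(2^{en})` for ONE constant `e`** — the form
in which Buhrman–Fortnow–Pavan's proof of their Thm. 3.1 (and hence item 3 of the proof sketch of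
Hirahara's Lemma 3.4, "if `NE = E` and `pr-MA = pr-NP`, then `E ⊄ i.o.SIZE(2^{εn})` [BFP05]") consumes
`NE = E` ("[IKW02] showed that if `E = NE`, then there exists a fixed constant `e` such that
`NTIME(2ⁿ) ⊆ DTIME(2^{en})`"): the complete language `AvM.K U` of `NTIME(2^{O(n)})` under
linear-length reductions (`AvgNEU.K_mem_NTIME_lin`, `AvgNEU.exists_reduction`) is in
`NTIME(2^{c₁n}) ⊆ E` by `NTIME_two_pow_mul_subset_E_of_tally`, say in `DTIME(2^{e₀n})`, and every
`L ∈ NTIME(2ⁿ)` is its preimage under a reduction of slope `5`, whence `L ∈ DTIME(2^{(5e₀+1)n})`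
(verbatim the argument of `exists_NTIME_two_pow_subset_DTIME_of_DistNP_subset_AvgP`).
[Hirahara 2021 (ECCC TR21-058), Lemma 3.4 (proof sketch, items 1 and 3); Buhrman–Fortnow–Pavan
2005, proof of Thm. 3.1; Aaronson–van Melkebeek 2011, §3.3]
[cite: Hirahara2021, Lemma 3.4 (proof sketch, items 1 and 3)] [cite: BuhrmanFortnowPavan2004, Thm. 3.1 (proof)] -/
theorem exists_NTIME_two_pow_subset_DTIME_of_tally
    (H : ∃ c : ℕ, distClass coNP {tallyEnsemble} ⊆ Avg1DeltaP fun n => 1 - 1 / (n : ℝ) ^ c) :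
    ∃ e : ℕ, NTIME (fun n => 2 ^ n) ⊆ DTIME (fun n => 2 ^ (e * n)) := by
  obtain ⟨c₁, -, hK⟩ := AvgNEU.K_mem_NTIME_lin ClockedUA.U_mem_P
  have hKE : AvM.K ClockedUA.U ∈ E := NTIME_two_pow_mul_subset_E_of_tally H c₁ hK
  simp only [E, Set.mem_iUnion] at hKE
  obtain ⟨e₀, a₀, hdec⟩ := hKE
  have hdec' : TimeComputable (id : List Bool → List Bool) encodeBool (AvM.K ClockedUA.U).boolIndicator
      fun n => a₀ * 2 ^ (e₀ * n) + a₀ := hdec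
  refine ⟨5 * e₀ + 1, fun L hL => ?_⟩
  have hL' : L ∈ NTIME (fun n => 2 ^ (1 * n)) := by simpa only [Nat.one_mul] using hL
  obtain ⟨r, hr, β, hlen, hred⟩ := AvgNEU.exists_reduction hL'
  obtain ⟨p, hp⟩ := hr
  have hmono : Monotone fun n : ℕ => a₀ * 2 ^ (e₀ * n) + a₀ := fun x y hxy => by
    dsimp only
    have : 2 ^ (e₀ * x) ≤ 2 ^ (e₀ * y) := Nat.pow_le_pow_right two_pos (Nat.mul_le_mul_left e₀ hxy)
    exact Nat.add_le_add_right (Nat.mul_le_mul_left a₀ this) a₀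
  have hlen' : ∀ x : List Bool, (id (r x) : List Bool).length ≤
      (2 + 3 * 1) * (id x : List Bool).length + β := fun x => hlen x
  obtain ⟨C, hC⟩ := TimeComputable.comp_holds hdec' hp hmono (s := fun n => (2 + 3 * 1) * n + β) hlen'
  have hind : (AvM.K ClockedUA.U).boolIndicator ∘ r = L.boolIndicator := by
    funext x
    simp only [Function.comp_apply]
    rw [Bool.eq_iff_iff, ← Set.mem_iff_boolIndicator, ← Set.mem_iff_boolIndicator]
    exact (hred x).symm
  rw [hind] at hC
  -- the bound `C (p n + (a₀ 2^{e₀(5n+β)} + a₀) + (5n+β)) + C ≤ K' 2^{(5e₀+1)n} + K'`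
  obtain ⟨b, hb⟩ := TimeConstructible.exists_poly_le_two_pow_pow p le_rfl
  let K' : ℕ := C * b + C * a₀ * 2 ^ (e₀ * β) + 5 * C + (C * b + C * a₀ + C * β + C)
  refine ⟨K', ?_⟩
  obtain ⟨MC, hMC⟩ := hC
  refine ⟨MC, fun x => (hMC x).mono ?_⟩
  set n := (id x : List Bool).length with hn
  have hbn := hb n
  simp only [pow_one] at hbn
  set T := 2 ^ ((5 * e₀ + 1) * n) with hT
  have h2n : 2 ^ n ≤ T := Nat.pow_le_pow_right two_pos (by nlinarith)
  have hexp : 2 ^ (e₀ * ((2 + 3 * 1) * n + β)) = 2 ^ (e₀ * β) * 2 ^ (5 * e₀ * n) := by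
    rw [← pow_add]; ring_nf
  have h5 : 2 ^ (5 * e₀ * n) ≤ T := Nat.pow_le_pow_right two_pos (by nlinarith)
  have hnT : n ≤ T := Nat.lt_two_pow_self.le.trans h2n
  show C * (p.eval n + (a₀ * 2 ^ (e₀ * ((2 + 3 * 1) * n + β)) + a₀) + ((2 + 3 * 1) * n + β)) + C ≤
    K' * T + K'
  rw [hexp]
  have e1 : C * p.eval n ≤ C * b * T + C * b := by
    have := Nat.mul_le_mul_left C (hbn.trans (Nat.add_le_add_right (Nat.mul_le_mul_left b h2n) b))
    nlinarith
  have e2 : C * (a₀ * (2 ^ (e₀ * β) * 2 ^ (5 * e₀ * n))) ≤ C * a₀ * 2 ^ (e₀ * β) * T := by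
    have := Nat.mul_le_mul_left (C * a₀ * 2 ^ (e₀ * β)) h5
    nlinarith
  have e3 : C * ((2 + 3 * 1) * n) ≤ 5 * C * T := by nlinarith
  have hT1 : 1 ≤ T := Nat.one_le_two_pow
  have expand : C * (p.eval n + (a₀ * (2 ^ (e₀ * β) * 2 ^ (5 * e₀ * n)) + a₀) + ((2 + 3 * 1) * n + β)) + C =
      C * p.eval n + C * (a₀ * (2 ^ (e₀ * β) * 2 ^ (5 * e₀ * n))) + C * ((2 + 3 * 1) * n) +
        (C * a₀ + C * β + C) := by ring
  rw [expand]
  have eK : K' * T + K' = (C * b + C * a₀ * 2 ^ (e₀ * β) + 5 * C) * T +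
      (C * b + C * a₀ + C * β + C) * T + K' := by simp only [K']; ring
  rw [eK]
  nlinarith [e1, e2, e3, hT1, Nat.zero_le ((C * b + C * a₀ + C * β + C) * T),
    Nat.zero_le K']

end AvgTallyNE

/-! ### F. The statements under Hirahara's hypothesis `coNP × {U, T} ⊆ Avg¹_{1-n^{-c}} P` -/

/-- The tally half of Hirahara's hypothesis: `coNP × {U, T} ⊆ Avg¹_{1-n^{-c}} P` implies
`coNP × {T} ⊆ Avg¹_{1-n^{-c}} P` (`distClass` is monotone in the set of ensembles).
[Hirahara 2021 (ECCC TR21-058), p. 9 and Lemma 3.4] [cite: Hirahara2021, Lemma 3.4] -/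
theorem distClass_coNP_tally_subset_Avg1DeltaP_of_weak
    (hyp : ∃ c : ℕ, distClass coNP {uniformEnsemble, tallyEnsemble} ⊆
      Avg1DeltaP fun n => 1 - 1 / (n : ℝ) ^ c) :
    ∃ c : ℕ, distClass coNP {tallyEnsemble} ⊆ Avg1DeltaP fun n => 1 - 1 / (n : ℝ) ^ c := by
  obtain ⟨c, hc⟩ := hyp
  exact ⟨c, (distClass_mono le_rfl (Set.subset_insert _ _)).trans hc⟩

/-- **Hirahara 2021, Lemma 3.4, proof sketch, item 1 (Ben-David–Chor–Goldreich–Luby 1992):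
`coNP × {U, T} ⊆ Avg¹_{1-n^{-c}} P` for some constant `c` implies `NE = E`.** (Only the tally
ensemble `T` is used: "The reason why we consider the tally distribution `T` to be one of the hard
distributions solely comes from Lemma 3.4", p. 20.) The first of the four steps of the printed proof
sketch of Lemma 3.4 (the pseudorandom generator behind `pr-BPP = pr-P`, Thm. 4.2, Thm. 5.2 and
Thm. 8.9); items 2 ([KS04] `pr-MA = pr-NP`) and 3 ([BFP05] `E ⊄ i.o.SIZE(2^{εn})`) are not in the
tree, item 4 ([IW97]) is (`Complexity.impagliazzo_wigderson_holds`,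
`Complexity.PromiseBPP'_subset_PromiseP_of_avgHard_E`).
[Hirahara 2021 (ECCC TR21-058), Lemma 3.4 (p. 20), proof sketch, item 1; Ben-David–Chor–Goldreich–
Luby 1992; Buhrman–Fortnow–Pavan 2005, Thm. 3.5] [cite: Hirahara2021, Lemma 3.4 (proof sketch, item 1)] -/
theorem Hirahara2021_E_eq_NE_of_Avg1P
    (hyp : ∃ c : ℕ, distClass coNP {uniformEnsemble, tallyEnsemble} ⊆
      Avg1DeltaP fun n => 1 - 1 / (n : ℝ) ^ c) : E = NE :=
  AvgTallyNE.E_eq_NE_of_tally (distClass_coNP_tally_subset_Avg1DeltaP_of_weak hyp)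

/-- **Under Hirahara's hypothesis, `NTIME(2^{an}) ⊆ E` for every `a`** (the form consumed by
diagonal arguments at linear-exponential scale). [Hirahara 2021 (ECCC TR21-058), Lemma 3.4 (proof
sketch, item 1); BCGL92] [cite: Hirahara2021, Lemma 3.4 (proof sketch, item 1)] -/
theorem Hirahara2021_NTIME_two_pow_mul_subset_E_of_Avg1P
    (hyp : ∃ c : ℕ, distClass coNP {uniformEnsemble, tallyEnsemble} ⊆
      Avg1DeltaP fun n => 1 - 1 / (n : ℝ) ^ c) (a : ℕ) :
    NTIME (fun n => 2 ^ (a * n)) ⊆ E :=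
  AvgTallyNE.NTIME_two_pow_mul_subset_E_of_tally (distClass_coNP_tally_subset_Avg1DeltaP_of_weak hyp) a

/-- **Under Hirahara's hypothesis, `NTIME(2ⁿ) ⊆ DTIME(2^{en})` for one constant `e`** (the
[IKW02] form of `NE = E` used in Buhrman–Fortnow–Pavan's proof of `E ⊄ i.o.SIZE(2^{εn})`, item 3 of
the proof sketch of Lemma 3.4). [Hirahara 2021 (ECCC TR21-058), Lemma 3.4 (proof sketch, items 1
and 3); Buhrman–Fortnow–Pavan 2005, proof of Thm. 3.1]
[cite: Hirahara2021, Lemma 3.4 (proof sketch, items 1 and 3)] -/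
theorem Hirahara2021_exists_NTIME_two_pow_subset_DTIME_of_Avg1P
    (hyp : ∃ c : ℕ, distClass coNP {uniformEnsemble, tallyEnsemble} ⊆
      Avg1DeltaP fun n => 1 - 1 / (n : ℝ) ^ c) :
    ∃ e : ℕ, NTIME (fun n => 2 ^ n) ⊆ DTIME (fun n => 2 ^ (e * n)) :=
  AvgTallyNE.exists_NTIME_two_pow_subset_DTIME_of_tally (distClass_coNP_tally_subset_Avg1DeltaP_of_weak hyp)

end Literature.Computability.MetaComplexity

end
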